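import Summits.QuantumFields.BalabanUV.Beta.FP.TorusGaugeCovariance

/-!
# `BalabanUV.Beta.FP.TorusGaugeCovariancePairing` — road «FP» (binder row D1), route T, (T-ID) letter «GAUGE COVARIANCE OF THE PERIODISED ROOTED
# AVERAGING», companion of `FP/TorusGaugeCovariance` (p308208): the MASTER identity PAIRED WITH A COLUMN VECTOR — «`Q₀·W₀` against ANY gauge
# parameter `c` on the torus box = `#B ·` the coarse gradient of `c` read at the block roots» (so (C1) = `c` supported off the roots and
# (C2) «`Q₀·W₀ = D̄₀` on the block-constant sector» = `c` constant on `N`-blocks, in whatever index presentation the consumer gives `D̄₀`),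
# plus the bridge between the displayed root equation `Torus.proj N (x − ρ) = 0` and coordinatewise divisibility (the (UNI) holder's `rootOf` reading)

Unit `b2b-balaban-gan24-formalise-leaf-05` (gen 48); split off `TorusGaugeCovariance` v1.2 by the 400-line rule (journal [GAN24LEAF05-G48-STAGED-2]).
HONEST FRAMING (cell contract, verbatim): «discharging `BetaPertH` makes Bałaban's UV stability UNCONDITIONAL — a real constructive-QFT result; it is
NOT the continuum limit and NOT the Clay problem.»  HONEST DEPENDENCY: continuum YM on T⁴ ⇐ BetaPertH ∧ nine spine estimates (0/9 proved);
BetaPertH ⇐ (D1) ∧ (D4) ∧ CAP+tail; G-an2-4 gates asym, D1 and NE2/3/4.  NOT IN PRINT; OUR BOOKKEEPING ([folklore] finite sums).  No `Prop` is minted,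
nothing is cited; one bookkeeping `def` (`wrapPt` = `B6Lemma24Torus.wrap` bundled as a box point).  Discharges NO binder of row D1; NOT (T-ID) complete,
NOT (UNI), NOT SDF, NOT D1, NOT BetaPertH, NOT continuum, NOT Clay.

CONTENT.  §1 `wrapPt` (over PART A's `M_pos`), `tdelta_eq_ite_wrapPt`, **`sum_tdelta_mul`** (`Σ_s tdelta M x s · c s = c (wrapPt M x)`), **`perF_bhKAt_mul_tgrad_sum`** ∕
**`perF_bhKStepAt_mul_tgrad_sum`** (`Σ_s (Σ_q perF M (bhK(Step)At …) (p, inr κ) q · tgrad M q s) · c s = stepScale·[proj N p = 0]·#B·(c(wrapPt(p+ρ+N•e_κ)) − c(wrapPt(p+ρ)))`);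
§2 **`proj_sub_eq_zero_iff_dvd`** (`Torus.proj N (x − ρ) = 0 ↔ ∀ i, (N:ℤ) ∣ x i − ρ i`).  §3 (C1) in MATRIX form: `inrRows` (multiplier rows as a matrix) and
**`inrRows_perF_bhKStepAt_mul_tgrad_res`**: `Q₀ * W₀ = 0` with `W₀ := (tgrad M).submatrix id Subtype.val` on the non-root subtype (every `j`).
-/

noncomputable section

open scoped BigOperators
open Finset

namespace Summit.QuantumFields.BalabanUV.Beta.FP.TorusGaugeCovariancePairing

open Literature.Probability.LatticeModels (TorusSite Torus.proj Torus.proj_apply)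
open Literature.MathematicalPhysics.QuantumFieldTheory
open Literature.MathematicalPhysics.QuantumFieldTheory.Balaban1983to89
open Literature.MathematicalPhysics.QuantumFieldTheory.Balaban1983to89.Beta
open B6Lemma24Torus (pbox mem_pbox wrap wrap_eq_self wrap_congr)
open ExpKernelCalculus (MKer)
open AffineAveraging (Form0 Form1 box toSite unitVec unitVec_apply)
open OneStepResolventKernel (Fib)
open Summit.QuantumFields.BalabanUV.Beta.BorderedHessian (bhKAt bhKStepAt stepScale)
open Summit.QuantumFields.BalabanUV.Beta.FP.KernelPeriodisationFib (Idx perF)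
open Summit.QuantumFields.BalabanUV.Beta.FP.TorusGaugeCovariance

variable {d : ℕ}
/-! ## §1 Pairing with column vectors: `Q₀·W₀` against ANY gauge parameter `c` on the box; §2 the predicate bridge -/

section Pairing

variable (M : Fin (d + 1) → ℕ) [∀ μ, NeZero (M μ)]

/-- **the box representative of a lattice point, as a box point** (`B6Lemma24Torus.wrap` bundled with `wrap_mem_pbox`; positivity of the periods is
PART A's `GAN24.KernelPeriodisation.M_pos`). [our object] -/
def wrapPt (x : Fin (d + 1) → ℤ) : ↥(pbox M) :=
  ⟨wrap M x, B6Lemma24Torus.wrap_mem_pbox (Summit.QuantumFields.BalabanUV.Beta.GAN24.KernelPeriodisation.M_pos M) x⟩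

/-- unfolding `wrapPt`. -/
theorem wrapPt_coe (x : Fin (d + 1) → ℤ) : (wrapPt M x : Fin (d + 1) → ℤ) = wrap M x := rfl

/-- a box point is its own representative. -/
theorem wrapPt_of_mem (s : ↥(pbox M)) : wrapPt M (s : Fin (d + 1) → ℤ) = s := Subtype.ext (wrap_eq_self s.2)

/-- `tdelta M x s` is the indicator of `wrapPt M x = s`. -/
theorem tdelta_eq_ite_wrapPt (x : Fin (d + 1) → ℤ) (s : ↥(pbox M)) : tdelta M x s = if wrapPt M x = s then 1 else 0 := by
  rw [tdelta_apply]
  by_cases h : wrapPt M x = s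
  · rw [if_pos h, if_pos (by rw [← h]; rfl)]
  · rw [if_neg h, if_neg (show ¬ wrap M x = (s : Fin (d + 1) → ℤ) from fun e => h (Subtype.ext e))]

/-- **pairing the periodic indicator with a column vector evaluates it at the representative**: `Σ_s tdelta M x s · c s = c (wrapPt M x)`. -/
theorem sum_tdelta_mul (x : Fin (d + 1) → ℤ) (c : ↥(pbox M) → ℝ) : ∑ s : ↥(pbox M), tdelta M x s * c s = c (wrapPt M x) := by
  simp only [tdelta_eq_ite_wrapPt, ite_mul, one_mul, zero_mul, Finset.sum_ite_eq, Finset.mem_univ, if_true]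

variable {N : ℕ} [NeZero N] {r : Fin (d + 1) → ℕ}

/-- **`Q₀·W₀` AGAINST ANY GAUGE PARAMETER** (the MASTER identity paired with a column vector `c` on the box): the multiplier row `(p, inr κ)` of the
periodised rooted packed Hessian applied to the torus gradient of `c` is `[proj N p = 0] · #B · (c(wrapPt (p + ρ + N•e_κ)) − c(wrapPt (p + ρ)))` —
`#B` times the coarse gradient of `c` READ AT THE BLOCK ROOTS.  (C1) is `c` supported off the roots; (C2) «`Q₀·W₀ = D̄₀` on the block-constant sector»
is `c` constant on `N`-blocks, in whatever index presentation the consumer chooses for `D̄₀`. [folklore] -/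
theorem perF_bhKAt_mul_tgrad_sum (hr : r ∈ box (d + 1) N) (p : ↥(pbox M)) (κ : Fin (d + 1)) (c : ↥(pbox M) → ℝ) :
    ∑ s : ↥(pbox M), (∑ q : Idx M (Fib d), perF M (bhKAt d (toSite r) N) (p, Sum.inr κ) q * tgrad M q s) * c s
      = if Torus.proj N (p : Fin (d + 1) → ℤ) = 0 then
          ((box (d + 1) N).card : ℝ) *
            (c (wrapPt M ((p : Fin (d + 1) → ℤ) + toSite r + (N : ℤ) • unitVec κ)) - c (wrapPt M ((p : Fin (d + 1) → ℤ) + toSite r)))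
        else 0 := by
  simp only [perF_bhKAt_mul_tgrad M hr]
  split_ifs with hp
  · simp only [mul_sub, sub_mul, Finset.sum_sub_distrib, mul_assoc, ← Finset.mul_sum, sum_tdelta_mul]
  · simp only [zero_mul, Finset.sum_const_zero]

/-- the same at every step `j` (factor `stepScale d Lc j`). -/
theorem perF_bhKStepAt_mul_tgrad_sum {Lc : ℕ} [NeZero Lc] {r : Fin (d + 1) → ℕ} (hr : r ∈ box (d + 1) Lc) (j : ℕ) (p : ↥(pbox M))
    (κ : Fin (d + 1)) (c : ↥(pbox M) → ℝ) :
    ∑ s : ↥(pbox M), (∑ q : Idx M (Fib d), perF M (bhKStepAt d (toSite r) Lc j) (p, Sum.inr κ) q * tgrad M q s) * c s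
      = stepScale d Lc j *
          (if Torus.proj Lc (p : Fin (d + 1) → ℤ) = 0 then
            ((box (d + 1) Lc).card : ℝ) *
              (c (wrapPt M ((p : Fin (d + 1) → ℤ) + toSite r + (Lc : ℤ) • unitVec κ)) - c (wrapPt M ((p : Fin (d + 1) → ℤ) + toSite r)))
           else 0) := by
  rw [← perF_bhKAt_mul_tgrad_sum M hr p κ c, Finset.mul_sum]
  refine Finset.sum_congr rfl fun s _ => ?_
  rw [perF_bhKStepAt_mul_tgrad M hr, perF_bhKAt_mul_tgrad M hr, mul_assoc]

omit [∀ μ, NeZero (M μ)] [NeZero N] in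
/-- **PREDICATE BRIDGE** (for the (UNI) holder's `rootOf`-reading, `TorusCombForest.eq_rootOf_iff_dvd`): the displayed root equation is
coordinatewise divisibility, `Torus.proj N (x − ρ) = 0 ↔ ∀ i, (N : ℤ) ∣ x i − ρ i`. -/
theorem proj_sub_eq_zero_iff_dvd (ρ : Fin (d + 1) → ℤ) (N : ℕ) (x : Fin (d + 1) → ℤ) :
    Torus.proj N (x - ρ) = 0 ↔ ∀ i, (N : ℤ) ∣ x i - ρ i := by
  constructor
  · intro h i
    have hi := congr_fun h i
    simp only [Torus.proj_apply, Pi.sub_apply, Pi.zero_apply] at hi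
    exact (ZMod.intCast_zmod_eq_zero_iff_dvd _ N).1 (by exact_mod_cast hi)
  · intro h
    funext i
    simp only [Torus.proj_apply, Pi.sub_apply, Pi.zero_apply]
    exact_mod_cast (ZMod.intCast_zmod_eq_zero_iff_dvd _ N).2 (h i)

end Pairing

/-! ## §3 (C1) in MATRIX form: `Q₀ * W₀ = 0` on the residual columns -/

section MatrixForm

variable (M : Fin (d + 1) → ℕ) [∀ μ, NeZero (M μ)]

/-- **the multiplier rows of a periodised kernel as a matrix** `↥(pbox M) × Fin (d+1)` (coarse-bond slots `(p, κ)`) `× Idx M (Fib d)`: row `(p, κ)` = the packed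
row `(p, inr κ)`.  (Rows at non-coarse `p` are zero for the road's kernels; the consumer restricts to its multiplier index `μ` by one more `submatrix`.) [our object] -/
def inrRows (X : Matrix (Idx M (Fib d)) (Idx M (Fib d)) ℝ) : Matrix (↥(pbox M) × Fin (d + 1)) (Idx M (Fib d)) ℝ :=
  fun pκ q => X (pκ.1, Sum.inr pκ.2) q

omit [∀ μ, NeZero (M μ)] in
/-- unfolding `inrRows`. -/
theorem inrRows_apply (X : Matrix (Idx M (Fib d)) (Idx M (Fib d)) ℝ) (p : ↥(pbox M)) (κ : Fin (d + 1)) (q : Idx M (Fib d)) :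
    inrRows M X (p, κ) q = X (p, Sum.inr κ) q := rfl

/-- **(C1) IN MATRIX FORM — `Q₀ * W₀ = 0`**: the multiplier rows of the periodised step-`j` packed Hessian times the torus gradient columns RESTRICTED TO
THE NON-ROOT box points (the residual gauge parameters of the rooted comb chart) is the zero matrix (`Lc ∣ M i`, in-block root, every `j`). [folklore] -/
theorem inrRows_perF_bhKStepAt_mul_tgrad_res {Lc : ℕ} [NeZero Lc] {r : Fin (d + 1) → ℕ} (hr : r ∈ box (d + 1) Lc) (hM : ∀ i, Lc ∣ M i) (j : ℕ) :
    inrRows M (perF M (bhKStepAt d (toSite r) Lc j))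
        * (tgrad M).submatrix id (Subtype.val : {s : ↥(pbox M) // Torus.proj Lc ((s : Fin (d + 1) → ℤ) - toSite r) ≠ 0} → ↥(pbox M))
      = 0 := by
  ext ⟨p, κ⟩ s
  rw [Matrix.mul_apply, Matrix.zero_apply]
  simp only [inrRows_apply, Matrix.submatrix_apply, id]
  exact perF_bhKStepAt_mul_tgrad_of_not_root M hr hM j p κ s.2

end MatrixForm

end Summit.QuantumFields.BalabanUV.Beta.FP.TorusGaugeCovariancePairing

end
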